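import Mathlib
import Literature.FieldTheory.AlgClosed.AutomorphismExtension
import Literature.FieldTheory.AlgClosed.PadicAlgClEquivComplex
import HarnessLib

/-!
# Every `3`-adic place of `ℤ̄ ⊂ ℂ` is the place of an isomorphism `ℚ̄₃ ≃ ℂ`

Stub `stub_placeOfMaximalIdeal` of the line `split-ramified-prime-sqrt6` for the crux
`Summit.Langlands.Langlands.Theses.PicardMuOrdinary.IrregularClassicality`.

For a maximal ideal `𝔐 ∋ 3` of `ℤ̄ = integralClosure ℤ ℂ` there is a ring isomorphism
`ι : PadicAlgCl 3 ≃+* ℂ` under which `𝔐`-adic divisibility by `3 ^ k` becomes `3`-adic smallness: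
if `u * z ∈ 3 ^ k ℤ̄` for some `u ∉ 𝔐` then `‖ι⁻¹ z‖ ≤ 3⁻ᵏ`.

Proof.  (A) An element of `ℚ̄ₚ = PadicAlgCl p` which is integral over `ℤ` has norm `≤ 1` (the
closed unit ball is the valuation ring of the `p`-adic valuation, which is integrally closed).
Hence for ANY `ι₀ : ℚ̄₃ ≃+* ℂ` the set `𝔐₀ = {z ∈ ℤ̄ | ‖ι₀⁻¹ z‖ < 1}` is a prime ideal of `ℤ̄`
containing `3`.  (B) `Gal(ℚ̄/ℚ)` (`ℚ̄ = algebraicClosure ℚ ℂ`, a profinite group for the Krull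
topology) acts continuously on the discrete ring `integralClosure ℤ ℚ̄ ≅ ℤ̄` with invariants `ℤ`,
so by Mathlib's `Algebra.IsInvariant.exists_smul_of_under_eq_of_profinite` it is transitive on the
primes of `ℤ̄` above `3ℤ`; an element `g` carrying `𝔐` to `𝔐₀` extends to an automorphism `σ` of
`ℂ` (`Literature.FieldTheory.AlgClosed.Complex.exists_ringEquiv_apply_eq_ringHom`, `ℚ̄` being
countable).  (C) `ι := σ⁻¹ ∘ ι₀` has `𝔐 ⊆ {‖ι⁻¹ ·‖ < 1}`, hence equality by maximality, and then
`u z = 3 ^ k a` with `‖ι⁻¹ u‖ = 1` gives `‖ι⁻¹ z‖ = 3⁻ᵏ ‖ι⁻¹ a‖ ≤ 3⁻ᵏ`.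
-/

set_option linter.dupNamespace false -- project-wide option (lakefile weak.linter.dupNamespace); `Summit.Langlands.Langlands` is the mandated namespace

noncomputable section

open scoped Pointwise NNReal NumberField
open Cardinal

namespace Summit.Langlands.Langlands.Theorems.IrregularClassicality.SplitRamifiedPrimeSqrt6

/-! ## (A) `p`-adic bookkeeping on `PadicAlgCl p` -/

/-- An element of `ℚ̄ₚ` which is integral over `ℤ` lies in the closed unit ball (the valuation
ring of `ℚ̄ₚ` contains `ℤ` and is integrally closed). -/
theorem padicAlgCl_norm_le_one_of_isIntegral {p : ℕ} [Fact p.Prime] {y : PadicAlgCl p}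
    (hy : IsIntegral ℤ y) : ‖y‖ ≤ 1 := by
  have hv := Valuation.integer.integers (Valued.v (R := PadicAlgCl p) (Γ₀ := ℝ≥0))
  have h : IsIntegral (Valued.v (R := PadicAlgCl p) (Γ₀ := ℝ≥0)).integer y := hy.tower_top
  have h1 := hv.isIntegral_iff_v_le_one.mp h
  rw [PadicAlgCl.valuation_def] at h1
  exact_mod_cast h1

/-- `‖p‖ = p⁻¹` in `ℚ̄ₚ`. -/
theorem padicAlgCl_norm_natCast_self (p : ℕ) [Fact p.Prime] :
    ‖(p : PadicAlgCl p)‖ = (p : ℝ)⁻¹ := by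
  rw [← map_natCast (algebraMap ℚ_[p] (PadicAlgCl p)), norm_algebraMap', Padic.norm_p]

/-- For a ring homomorphism `ψ : R → ℚ̄ₚ` with values in the closed unit ball, the elements of
open-unit-ball norm form a prime ideal of `R`. -/
theorem exists_ideal_mem_iff_norm_lt_one {R : Type*} [CommRing R] {p : ℕ} [Fact p.Prime]
    (ψ : R →+* PadicAlgCl p) (hψ : ∀ r, ‖ψ r‖ ≤ 1) :
    ∃ I : Ideal R, I.IsPrime ∧ ∀ r, r ∈ I ↔ ‖ψ r‖ < 1 := by
  let I : Ideal R :=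
    { carrier := {r | ‖ψ r‖ < 1}
      add_mem' := fun {a b} ha hb => by
        simp only [Set.mem_setOf_eq, map_add] at ha hb ⊢
        exact (PadicAlgCl.isNonarchimedean p _ _).trans_lt (max_lt ha hb)
      zero_mem' := by simp
      smul_mem' := fun c {x} hx => by
        simp only [Set.mem_setOf_eq, smul_eq_mul, map_mul, norm_mul] at hx ⊢
        calc ‖ψ c‖ * ‖ψ x‖ ≤ 1 * ‖ψ x‖ := by gcongr; exact hψ c
          _ < 1 := by rw [one_mul]; exact hx }
  refine ⟨I, Ideal.isPrime_iff.mpr ⟨?_, fun {x y} hxy => ?_⟩, fun r => Iff.rfl⟩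
  · rw [Ideal.ne_top_iff_one]
    change ¬ (‖ψ 1‖ < 1)
    simp
  · change ‖ψ (x * y)‖ < 1 at hxy
    change ‖ψ x‖ < 1 ∨ ‖ψ y‖ < 1
    by_contra! h
    rw [map_mul, norm_mul] at hxy
    nlinarith [h.1, h.2, norm_nonneg (ψ x), norm_nonneg (ψ y)]

/-! ## (B) Galois groups are transitive on the primes of a ring of integers -/

/-- **Transitivity for a possibly infinite Galois extension of `ℚ`.**  Let `K/ℚ` be Galois and
`P`, `Q` prime ideals of `𝓞 K = integralClosure ℤ K` lying over the same prime of `ℤ`.  Then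
`Q = g • P` for some `g ∈ Gal(K/ℚ)`.  (`Gal(K/ℚ)` is profinite for the Krull topology and acts
continuously on the discrete ring `𝓞 K` — stabilisers contain the open subgroups `Gal(K/ℚ(b))` —
with ring of invariants `ℤ` (`ℤ` is integrally closed), so Mathlib's
`Algebra.IsInvariant.exists_smul_of_under_eq_of_profinite` applies.) -/
theorem exists_smul_eq_of_under_eq_of_isGalois (K : Type*) [Field K] [Algebra ℚ K]
    [IsGalois ℚ K] (P Q : Ideal (𝓞 K)) [P.IsPrime] [Q.IsPrime] (hPQ : P.under ℤ = Q.under ℤ) :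
    ∃ g : K ≃ₐ[ℚ] K, Q = g • P := by
  letI : TopologicalSpace (𝓞 K) := ⊥
  haveI : DiscreteTopology (𝓞 K) := ⟨rfl⟩
  haveI : ContinuousSMul (K ≃ₐ[ℚ] K) (𝓞 K) := by
    rw [continuousSMul_iff_stabilizer_isOpen]
    intro b
    have : MulAction.stabilizer (K ≃ₐ[ℚ] K) b = MulAction.stabilizer (K ≃ₐ[ℚ] K) (b : K) := by
      ext g
      rw [MulAction.mem_stabilizer_iff, MulAction.mem_stabilizer_iff,
        ← NumberField.RingOfIntegers.eq_iff]
      rfl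
    rw [this]
    exact stabilizer_isOpen_of_isIntegral (b : K)
  haveI : Algebra.IsInvariant ℤ (𝓞 K) (K ≃ₐ[ℚ] K) := by
    refine ⟨fun b hb => ?_⟩
    have hb' : ∀ g : K ≃ₐ[ℚ] K, g (b : K) = b := fun g =>
      congrArg (fun x : 𝓞 K => (x : K)) (hb g)
    obtain ⟨q, hq⟩ := (InfiniteGalois.mem_range_algebraMap_iff_fixed (b : K)).mpr hb'
    have hqi : IsIntegral ℤ q := by
      have hbi : IsIntegral ℤ (b : K) := NumberField.RingOfIntegers.isIntegral_coe b
      rw [← hq, isIntegral_algebraMap_iff (algebraMap ℚ K).injective] at hbi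
      exact hbi
    obtain ⟨a, ha⟩ := IsIntegrallyClosed.algebraMap_eq_of_integral hqi
    refine ⟨a, NumberField.RingOfIntegers.ext ?_⟩
    rw [NumberField.RingOfIntegers.coe_eq_algebraMap, ← IsScalarTower.algebraMap_apply,
      IsScalarTower.algebraMap_apply ℤ ℚ K, ha, hq]
  exact Algebra.IsInvariant.exists_smul_of_under_eq_of_profinite P Q hPQ

/-- **`Aut(ℂ)` is transitive on the primes of `ℤ̄ ⊂ ℂ` above a rational prime.**  If two prime
ideals `P`, `Q` of `ℤ̄ = integralClosure ℤ ℂ` lie over the same prime of `ℤ`, some automorphism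
`σ` of `ℂ` carries `P` onto `Q`: for `z, w ∈ ℤ̄` with `w = σ z`, `z ∈ P ↔ w ∈ Q`.  (Apply
`exists_smul_eq_of_under_eq_of_isGalois` to `ℚ̄ = algebraicClosure ℚ ℂ`, whose ring of integers
`𝓞 ℚ̄` is identified with `ℤ̄`, and extend the Galois element to `ℂ`, `ℚ̄` being countable:
`Literature.FieldTheory.AlgClosed.Complex.exists_ringEquiv_apply_eq_ringHom`.) -/
theorem exists_ringEquiv_complex_mem_iff_of_under_eq
    (P Q : Ideal (integralClosure ℤ ℂ)) [P.IsPrime] [Q.IsPrime] (hPQ : P.under ℤ = Q.under ℤ) :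
    ∃ σ : ℂ ≃+* ℂ, ∀ z w : integralClosure ℤ ℂ, (w : ℂ) = σ z → (z ∈ P ↔ w ∈ Q) := by
  classical
  -- `ℚ̄ ⊂ ℂ` is an algebraic closure of `ℚ` (for the canonical `ℚ`-algebra structure)
  haveI : IsAlgClosure ℚ (algebraicClosure ℚ ℂ) :=
    { isAlgClosed := (algebraicClosure.isAlgClosure ℚ ℂ).isAlgClosed
      isAlgebraic := ⟨fun x =>
        (isAlgebraic_algHom_iff (algebraMap (algebraicClosure ℚ ℂ) ℂ).toRatAlgHom
          (algebraMap (algebraicClosure ℚ ℂ) ℂ).injective).mp (mem_algebraicClosure_iff.mp x.2)⟩ }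
  -- the identification `𝓞 ℚ̄ ≅ ℤ̄`
  let φ : 𝓞 (algebraicClosure ℚ ℂ) →+* integralClosure ℤ ℂ :=
    { toFun := fun b => ⟨((b : algebraicClosure ℚ ℂ) : ℂ),
        map_isIntegral_int (algebraMap (algebraicClosure ℚ ℂ) ℂ)
          (NumberField.RingOfIntegers.isIntegral_coe b)⟩
      map_one' := rfl
      map_mul' := fun _ _ => rfl
      map_zero' := rfl
      map_add' := fun _ _ => rfl }
  have hφ : ∀ b, (φ b : ℂ) = ((b : algebraicClosure ℚ ℂ) : ℂ) := fun b => rfl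
  have hφsurj : ∀ z : integralClosure ℤ ℂ, ∃ b, φ b = z := by
    intro z
    have hzi : IsIntegral ℤ (z : ℂ) := z.2
    have hzF : (z : ℂ) ∈ algebraicClosure ℚ ℂ := by
      rw [mem_algebraicClosure_iff]
      exact (hzi.tower_top (A := ℚ)).isAlgebraic
    refine ⟨⟨⟨z, hzF⟩, ?_⟩, Subtype.ext rfl⟩
    exact (isIntegral_algHom_iff (algebraMap (algebraicClosure ℚ ℂ) ℂ).toIntAlgHom
      (algebraMap (algebraicClosure ℚ ℂ) ℂ).injective).mp hzi
  have hunder : ∀ I : Ideal (integralClosure ℤ ℂ), (I.comap φ).under ℤ = I.under ℤ := by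
    intro I
    rw [Ideal.under, Ideal.under, Ideal.comap_comap]
    congr 1
  obtain ⟨g, hg⟩ := exists_smul_eq_of_under_eq_of_isGalois (algebraicClosure ℚ ℂ)
    (P.comap φ) (Q.comap φ) (by rw [hunder, hunder, hPQ])
  -- extend `g` to an automorphism of `ℂ`
  have hcard : #(algebraicClosure ℚ ℂ) ≤ ℵ₀ := by
    refine (Algebra.IsAlgebraic.cardinalMk_le_max ℚ (algebraicClosure ℚ ℂ)).trans ?_
    simp
  obtain ⟨σ, hσ⟩ := Literature.FieldTheory.AlgClosed.Complex.exists_ringEquiv_apply_eq_ringHom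
    (algebraicClosure ℚ ℂ) hcard
    ((algebraMap (algebraicClosure ℚ ℂ) ℂ).comp (g : algebraicClosure ℚ ℂ →+* algebraicClosure ℚ ℂ))
  refine ⟨σ, fun z w hw => ?_⟩
  obtain ⟨b, rfl⟩ := hφsurj z
  have hw' : w = φ (g • b) := by
    apply Subtype.ext
    rw [hw, hφ, hφ]
    exact hσ (b : algebraicClosure ℚ ℂ)
  rw [hw']
  change b ∈ P.comap φ ↔ g • b ∈ Q.comap φ
  rw [hg, Ideal.smul_mem_pointwise_smul_iff]

/-! ## (C) The stub -/

/-- **Stub 1 — every `3`-adic place of `ℤ̄ ⊂ ℂ` is the place of an isomorphism `ℚ̄₃ ≃ ℂ`.**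
For a maximal ideal `𝔐 ∋ 3` of `ℤ̄ = integralClosure ℤ ℂ` there is a ring isomorphism
`ι : PadicAlgCl 3 ≃+* ℂ` under which `𝔐`-adic divisibility becomes `3`-adic smallness: if
`u * z ∈ 3 ^ k ℤ̄` for some `u ∉ 𝔐` (i.e. `v_𝔐(z) ≥ k`) then `‖ι⁻¹ z‖ ≤ 3⁻ᵏ`. -/
theorem stub_placeOfMaximalIdeal :
    ∀ (𝔐 : Ideal (integralClosure ℤ ℂ)), 𝔐.IsMaximal → (3 : integralClosure ℤ ℂ) ∈ 𝔐 →
    ∃ ι : PadicAlgCl 3 ≃+* ℂ,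
      ∀ (z : integralClosure ℤ ℂ) (k : ℕ),
        (∃ u : integralClosure ℤ ℂ, u ∉ 𝔐 ∧ u * z ∈ Ideal.span {(3 : integralClosure ℤ ℂ) ^ k}) →
        ‖ι.symm (z : ℂ)‖ ≤ ((3 : ℝ)⁻¹) ^ k := by
  haveI : Fact (Nat.Prime 3) := ⟨Nat.prime_three⟩
  intro 𝔐 h𝔐 h3
  -- norms of integral elements under any `ι`
  have hle : ∀ (ι : PadicAlgCl 3 ≃+* ℂ) (z : integralClosure ℤ ℂ), ‖ι.symm (z : ℂ)‖ ≤ 1 :=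
    fun ι z => padicAlgCl_norm_le_one_of_isIntegral (map_isIntegral_int ι.symm.toRingHom z.2)
  have h3norm : ‖(3 : PadicAlgCl 3)‖ = (3 : ℝ)⁻¹ := by
    exact_mod_cast padicAlgCl_norm_natCast_self 3
  -- the ideal `{‖ι⁻¹ ·‖ < 1}` of an isomorphism `ι`
  have hideal : ∀ ι : PadicAlgCl 3 ≃+* ℂ, ∃ I : Ideal (integralClosure ℤ ℂ),
      I.IsPrime ∧ (3 : integralClosure ℤ ℂ) ∈ I ∧ ∀ r, r ∈ I ↔ ‖ι.symm (r : ℂ)‖ < 1 := by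
    intro ι
    obtain ⟨I, hI, hmem⟩ := exists_ideal_mem_iff_norm_lt_one
      (ι.symm.toRingHom.comp (algebraMap (integralClosure ℤ ℂ) ℂ)) (fun r => hle ι r)
    refine ⟨I, hI, ?_, fun r => hmem r⟩
    rw [hmem]
    change ‖ι.symm ((3 : integralClosure ℤ ℂ) : ℂ)‖ < 1
    rw [show ((3 : integralClosure ℤ ℂ) : ℂ) = 3 from rfl, map_ofNat, h3norm]
    norm_num
  -- a first isomorphism and its ideal
  obtain ⟨ι₀⟩ := PadicAlgCl.nonempty_ringEquiv_complex 3
  obtain ⟨𝔐₀, h𝔐₀, h3₀, hmem₀⟩ := hideal ι₀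
  -- both `𝔐` and `𝔐₀` lie over `3ℤ`
  have hunder : ∀ I : Ideal (integralClosure ℤ ℂ), I.IsPrime → (3 : integralClosure ℤ ℂ) ∈ I →
      I.under ℤ = Ideal.span {(3 : ℤ)} := by
    intro I hI h3I
    have hmax : (Ideal.span {(3 : ℤ)}).IsMaximal :=
      ((Ideal.span_singleton_prime (by norm_num)).mpr Int.prime_three).isMaximal (by simp)
    refine (hmax.eq_of_le (Ideal.IsPrime.ne_top inferInstance) ?_).symm
    rw [Ideal.span_le, Set.singleton_subset_iff]
    change algebraMap ℤ (integralClosure ℤ ℂ) 3 ∈ I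
    simpa using h3I
  haveI := h𝔐.isPrime
  haveI := h𝔐₀
  obtain ⟨σ, hσ⟩ := exists_ringEquiv_complex_mem_iff_of_under_eq 𝔐 𝔐₀
    (by rw [hunder 𝔐 h𝔐.isPrime h3, hunder 𝔐₀ h𝔐₀ h3₀])
  -- the corrected isomorphism
  let ι : PadicAlgCl 3 ≃+* ℂ := ι₀.trans σ.symm
  have hι : ∀ x : ℂ, ι.symm x = ι₀.symm (σ x) := fun x => rfl
  obtain ⟨𝔐₁, h𝔐₁, -, hmem₁⟩ := hideal ι
  -- `𝔐 = 𝔐₁`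
  have hle₁ : 𝔐 ≤ 𝔐₁ := by
    intro z hz
    rw [hmem₁, hι, ← hmem₀ ⟨σ z, map_isIntegral_int σ.toRingHom z.2⟩]
    exact (hσ z ⟨σ z, map_isIntegral_int σ.toRingHom z.2⟩ rfl).mp hz
  have heq : 𝔐 = 𝔐₁ := h𝔐.eq_of_le h𝔐₁.ne_top hle₁
  refine ⟨ι, fun z k ⟨u, hu, huz⟩ => ?_⟩
  -- `‖ι⁻¹ u‖ = 1`
  have hu1 : ‖ι.symm (u : ℂ)‖ = 1 := by
    refine le_antisymm (hle ι u) ?_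
    rw [heq, hmem₁] at hu
    exact not_lt.mp hu
  obtain ⟨a, ha⟩ := Ideal.mem_span_singleton'.mp huz
  -- `a * 3 ^ k = u * z`
  have hz : ‖ι.symm (z : ℂ)‖ = ‖ι.symm ((u * z : integralClosure ℤ ℂ) : ℂ)‖ := by
    rw [Subalgebra.coe_mul, map_mul, norm_mul, hu1, one_mul]
  rw [hz, ← ha, Subalgebra.coe_mul, Subalgebra.coe_pow, map_mul, map_pow, norm_mul, norm_pow,
    show ((3 : integralClosure ℤ ℂ) : ℂ) = 3 from rfl, map_ofNat, h3norm]
  calc ‖ι.symm (a : ℂ)‖ * ((3 : ℝ)⁻¹) ^ k ≤ 1 * ((3 : ℝ)⁻¹) ^ k := by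
        gcongr; exact hle ι a
    _ = ((3 : ℝ)⁻¹) ^ k := one_mul _

end Summit.Langlands.Langlands.Theorems.IrregularClassicality.SplitRamifiedPrimeSqrt6
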